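import Summits.PneNP.PneNP.Theorems.ExpanderLinearGeneratorsResolutionRung
import Literature.Computability.MetaComplexity.ResolutionProofs
import HarnessLib

/-!
# The n-free resolution-size rung for expanding linear systems, VIII: calibration against the crux

Support file for crux `stmt-PneNP-11442`
(`Summit.PneNP.PneNP.Theses.ExpanderLinearGenerators.ExpansionForcesDepthFregeSize`). Files I–VII
prove what is provable NOW at the resolution rung of the expansion-scale law (polynomial n-free law
for the 1-bit encoding, exponential n-free laws for twin-closed systems and the 2-bit encoding).
This file records, kernel-checked, how the CRUX itself sits above that rung: through the tree's
simulation of resolution by depth-`11` `textbookFrege` (`ResSim.exists_proof_of_isResRefutation`,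
polynomial overhead), the crux implies the n-free resolution law UP TO A POLYNOMIAL IN `m + n`
(`resolution_bound_of_expansionForcesDepthFregeSize`):

  crux ⇒ ∀ ℓ ≥ 1 ∃ ε > 0 ∃ R ∀ r ≥ R ∀ n m E (ℓ-sparse, (r, 3ℓ/4)-expanding) ∀ resolution
  refutations ρ of `sumEncoding 1 E`: `2^{r^ε} ≤ (|ρ| + 1) · 22800 · (2^{ℓ+3} (ℓ+1) (m+n+1))³`.

Contrapositively: a family of `ℓ`-sparse `(r, 3ℓ/4)`-boundary expanders with `m, n ≤ 2^{r^{o(1)}}`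
and resolution refutations of length `2^{r^{o(1)}}` REFUTES the crux (at depth `d = 11`). This is
the exact sense in which the open n-free exponential resolution law ("Q" of the session memo) is
the cheapest decisive experiment for the crux.

References: J. Krajíček, *Proof complexity* (CUP 2019), §13.4, Problem 19.4.5; E. Ben-Sasson,
A. Wigderson, J. ACM 48 (2001).
-/

namespace Summit.PneNP.PneNP.Theorems.ResNFree

set_option linter.dupNamespace false -- `Summit.PneNP.PneNP.…`: summit = sub-problem (D-0017)

open Finset Literature.Computability.Complexity Literature.Computability.MetaComplexity
open Literature.Computability.Complexity.PropForm
open Summit.PneNP.PneNP.Theorems.ResSim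

/-- **The crux implies the n-free resolution law up to a polynomial in `m + n`.** If
`ExpansionForcesDepthFregeSize` holds then for every `ℓ ≥ 1` there are `ε > 0` and `R` such that
for all `r ≥ R`, all `n, m`, every `ℓ`-sparse `E : Fin m → LinEqMod 2 n` with
`(r, 3ℓ/4)`-boundary-expanding supports and every resolution refutation `ρ` of `sumEncoding 1 E`,
`2^{r^ε} ≤ (|ρ| + 1) · 22800 · (2^{ℓ+3} (ℓ+1) (m+n+1))³` (restrict `ρ` to the variables `< n`,
simulate it by a depth-`11` `textbookFrege` proof of polynomial size, apply the crux at `d = 11`).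
[Krajíček 2019, §13.4, Problem 19.4.5] [folklore] -/
theorem resolution_bound_of_expansionForcesDepthFregeSize
    (hcrux : Summit.PneNP.PneNP.Theses.ExpanderLinearGenerators.ExpansionForcesDepthFregeSize)
    (ℓ : ℕ) (hℓ : 1 ≤ ℓ) :
    ∃ ε : ℝ, 0 < ε ∧ ∃ R : ℝ, ∀ r : ℝ, R ≤ r → ∀ (n m : ℕ) (E : Fin m → LinEqMod 2 n),
      (∀ i, (E i).supp.card ≤ ℓ) →
      IsBoundaryExpander (fun i => (E i).supp.map Fin.valEmbedding) r (3 / 4 * ℓ) →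
      ∀ ρ : List (ResLine ℕ), IsResRefutation (sumEncoding 1 E) ρ →
        (2 : ℝ) ^ (r ^ ε) ≤ ((ρ.length : ℝ) + 1) *
          (22800 * ((2 : ℝ) ^ (ℓ + 3) * ((ℓ : ℝ) + 1) * ((m : ℝ) + n + 1)) ^ 3) := by
  classical
  obtain ⟨ε, hε, R, hR⟩ := hcrux ℓ 11 hℓ
  refine ⟨ε, hε, R, fun r hr n m E hsparse hexp ρ hρ => ?_⟩
  -- unsolvability from the refutation
  have hunsat : ¬ SystemSat E Finset.univ := fun hsat =>
    not_satisfiable_of_isResRefutation_holds hρ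
      ((sumEncoding_satisfiable_iff (p := 2) (B := 1) (by norm_num) (by norm_num) E).2 hsat)
  -- restriction to the variables `< n` and simulation by depth-11 textbookFrege
  set T := sumEncoding 1 E with hT
  obtain ⟨ρ', hρ', hlen, hW⟩ := exists_restricted_refutation (T := T) (N := n)
    (fun c hc l hl => fst_lt_of_mem_sumEncoding_one E hc hl) hρ
  obtain ⟨π, hπ, hsize⟩ := exists_proof_of_isResRefutation T ρ' (2 * n) hW hρ'
  -- the crux at depth 11
  have hlb := hR r hr n m E hsparse hexp hunsat π hπ
  -- the polynomial bound on the simulation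
  obtain ⟨hTl, hΦs⟩ := sizes_sumEncoding_le E hsparse
  set A : ℕ := 2 ^ ℓ with hA
  set P : ℕ := 2 ^ (ℓ + 3) * (ℓ + 1) * (m + n + 1) with hP
  have hA1 : 1 ≤ A := Nat.one_le_two_pow
  have hPA : P = 8 * A * (ℓ + 1) * (m + n + 1) := by rw [hP, hA, pow_add]; ring
  set X : ℕ := A * (ℓ + 1) with hX
  have hX2 : 2 ≤ X := by
    have := Nat.mul_le_mul hA1 (show 2 ≤ ℓ + 1 by omega)
    simpa [hX] using this
  have e1 : m * (A * (3 * ℓ + 2)) + m * A = 3 * (X * m) := by rw [hX]; ring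
  have e2 : 8 * A * (ℓ + 1) * (m + n + 1) = 8 * (X * m) + 8 * (X * n) + 8 * X := by rw [hX]; ring
  have i1 : n ≤ X * n := Nat.le_mul_of_pos_left n (by omega)
  have h1 : (PropForm.ofCNF T).size ≤ m * (A * (3 * ℓ + 2)) + 1 := hΦs
  have h2 : T.length ≤ m * A := hTl
  have hK : (PropForm.ofCNF T).size + 2 * (2 * n) + T.length + 4 ≤ P := by
    rw [hPA, e2]
    omega
  have hLF : (PropForm.ofCNF T).size + 3 * (2 * n) + 3 ≤ P := by
    rw [hPA, e2]
    omega
  have hP1 : 1 ≤ P := by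
    rw [hPA, e2]
    omega
  have hsize' : proofSize π ≤ (ρ.length + 1) * (22800 * P ^ 3) := by
    rw [← hlen]
    refine hsize.trans ?_
    have h1 : 300 * ((PropForm.ofCNF T).size + 2 * (2 * n) + T.length + 4) ^ 2 ≤ 300 * P ^ 2 :=
      Nat.mul_le_mul_left _ (Nat.pow_le_pow_left hK 2)
    have h2 : 16 * ((PropForm.ofCNF T).size + 3 * (2 * n) + 3) + 60 ≤ 76 * P := by omega
    calc (ρ'.length + 1) * (300 * ((PropForm.ofCNF T).size + 2 * (2 * n) + T.length + 4) ^ 2) *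
          (16 * ((PropForm.ofCNF T).size + 3 * (2 * n) + 3) + 60)
        ≤ (ρ'.length + 1) * (300 * P ^ 2) * (76 * P) :=
          Nat.mul_le_mul (Nat.mul_le_mul_left _ h1) h2
      _ = (ρ'.length + 1) * (22800 * P ^ 3) := by ring
  have hsizeR : (proofSize π : ℝ) ≤ ((ρ.length : ℝ) + 1) * (22800 * (P : ℝ) ^ 3) := by
    exact_mod_cast hsize'
  have hPR : (P : ℝ) = (2 : ℝ) ^ (ℓ + 3) * ((ℓ : ℝ) + 1) * ((m : ℝ) + n + 1) := by
    rw [hP]; push_cast; ring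
  rw [← hPR]
  exact hlb.trans hsizeR

end Summit.PneNP.PneNP.Theorems.ResNFree
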